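import Summits.QuantumFields.BalabanUV.T4Continuum.Support.NE7EtaClosenessHolder
import Summits.QuantumFields.BalabanUV.T4Continuum.Support.NE7EtaSmoothGaugeTransport
import Summits.QuantumFields.BalabanUV.T4Continuum.Support.NE7EtaBackgroundCarrier
import HarnessLib

/-!
# NE7EtaPlainGradientHolder — route #1 of the NE7 crux (node U5), socket `h` AMENDMENT 5 (ROAD-G106 §4): the PLAIN (embedding) reading of the
# background coordinate from the amended socket `h′` = (E) + (Lip₁ᶜ) + (Höl½ᶜ) — gen 24's `NE7EtaPlainGradientLetters` ∕ `NE7EtaSmoothGaugeTransport`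
# and gen 25's `plainReading_le_rate` re-run at the rates of `NE7EtaClosenessHolder.closeness_of_covRootH` (base `θ^{18} = L⁻¹`: (P) `θ^{24k}`,
# (Gᶜ) `θ^{38k}`, smooth-gauge letters `θ^{18k}`)

Cell `pub-balaban`, rung (B)+1 sub-cell t4, lineage `b2b-balaban-t4-ne7-p1`, generation 106 (CRUX PROVER NE7 #1 = OWNER of BINDER row NE7).
Memo `t4/b2b-balaban-t4-ne7-p1-g106/ROAD-G106.md` §4.

WHAT ([folklore]; 0 def, 0 sorry).
 * §1 `letters_at_rates_H` — with `p = a·θ^{24k} ≤ 1`, `q = c·θ^{38k}`, smooth-gauge letters `σ₀θ^{18k}`, `σ₁θ^{18k}`, `0 < θ ≤ 1`: a bond distance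
   `D ≤ e^p − 1` is `≤ 2a·θ^{24k}` and a plain gradient `G ≤ σ₁θ^{18k}(e^p − 1) + 2·expRem p + q + 2σ₀θ^{18k}·p` is `≤ (c + 2a(σ₀ + σ₁) + 2a²)·θ^{38k}`
   (`18 + 24 = 42 ≥ 38`, `48 ≥ 38`); `plain_reading_le_H` — `max (D∕θ^{18k}) (G∕θ^{36k}) ≤ (A + C_G)·θ^k` from `D ≤ Aθ^{24k}`, `G ≤ C_Gθ^{38k}`.
 * §2 `plain_letters_of_rates_H` — `W` unitary with letters `σ₀θ^{18k}`, `σ₁θ^{18k}`; (P) `‖Z‖ ≤ aθ^{24k}` (`a = 8l₁²γ`, `aθ^{24k} ≤ 1`), (Gᶜ) `≤ cθ^{38k}` ⟹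
   (i) `‖(W e^Z)(b) − W(b)‖ ≤ 2a·θ^{24k}`, (ii) plain gradient `≤ (c + 2a(σ₀ + σ₁) + 2a²)·θ^{38k}`.
 * §3 **`plain_closeness_of_covRootH_oneLetter`** — the amended socket `h′` + ONE smooth-gauge letter on `U_B` (`U_B` bondwise `exp A_B`,
   `sup‖A_B‖ ≤ σ_B·θ^{18(k+1)}`, `10L·σ_Bθ^{18(k+1)} ≤ 1∕64`) ⟹ `∃ u Z` with the representation and (i) bond distance `≤ 16l₁²γ·θ^{24k}`, (ii) plain
   gradient `≤ ((16l₁²γ + √2Λ_H) + 16l₁²γ·(60σ_B) + 128l₁⁴γ²)·θ^{38k}`.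
 * §4 `pow_level_eq18`, **`plainReading_le_rate_H`** — bond distance `≤ A·θ^{24k}` and plain gradient `≤ C_G·θ^{38k}` ⟹
   `plainReading L N k U U′ ≤ (A + C_G)·θ^k` (`L^k = θ^{−18k}`).
HONEST FRAMING (page 1): bookkeeping over landed kernel lemmas; `h′` and the smooth-gauge letter are HYPOTHESES, asserted for no class; nothing of
NE3∕NE7 discharged; the hclose twin and the END re-threading are NOT in this file; nothing of Bałaban's asserted as an axiom; spine count =
dagwriter∕referees' call; FIXED FINITE T⁴, rung (B)+1 — NOT infinite volume, NOT mass gap, NOT BetaPertH, NOT Clay.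
-/

set_option autoImplicit false

open scoped BigOperators Matrix Matrix.Norms.L2Operator
open Finset NormedSpace

namespace Summit.QuantumFields.BalabanUV.T4Continuum.NE7EtaPlainGradientHolder

open Literature.MathematicalPhysics.QuantumFieldTheory.Balaban1983to89
open B7Prop1Explicit B7Prop2Explicit
open T4AveragingDeficitWall hiding Site Plane Plaq Bond
open T4AveragingDeficitWallBoundary (periodBox IsPeriodicCfg)
open AveragingDeficitPeriodicCounting (IsPeriodicDir)
open MinimalActionSandwich (IsMinimiser)
open MinimalActionRate (Regular)
open NE3EnergyShapes (residualScale IsUnitarySite IsPeriodicSite)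
open NE3EnergyWeightedShapes (energyNormW)
open AveragingDeficitDualResidual (dualC1 dualC2)
open AveragingDeficitDerivWallProof (wallConst)
open NE7EtaRatesD4CovReg (unitary_periodic_rescale_bavg_of_regular)
open NE7EtaPlainGradientLetters (norm_plainSup_le norm_plainGrad_le)
open NE7EtaSmoothGaugeTransport (norm_rescale_bavg_sub_one_le letter_grad_of_sup)
open NE7EtaClosenessHolder (closeness_of_covRootH)
open NE7EtaBackgroundCarrier (plainReading diffCfg reading_le)

noncomputable section

variable {n : Type*} [Fintype n] [DecidableEq n]

/-! ## §1 Real bookkeeping at the amended rates -/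

/-- **THE LETTERS AT RATE** (real bookkeeping; exponents `24`, `38`, `18`): statement in the module docstring. [folklore] -/
theorem letters_at_rates_H {θ a c σ₀ σ₁ p q D G : ℝ} {k : ℕ} (hθ : 0 < θ) (hθ1 : θ ≤ 1) (ha : 0 ≤ a) (hσ₀ : 0 ≤ σ₀)
    (hσ₁ : 0 ≤ σ₁) (hp : p = a * θ ^ (24 * k)) (hp1 : p ≤ 1) (hq : q = c * θ ^ (38 * k))
    (hD : D ≤ Real.exp p - 1)
    (hG : G ≤ σ₁ * θ ^ (18 * k) * (Real.exp p - 1) + 2 * expRem p + q + 2 * (σ₀ * θ ^ (18 * k)) * p) :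
    D ≤ 2 * a * θ ^ (24 * k) ∧ G ≤ (c + 2 * a * (σ₀ + σ₁) + 2 * a ^ 2) * θ ^ (38 * k) := by
  have hθk : ∀ m : ℕ, 0 ≤ θ ^ m := fun m => pow_nonneg hθ.le m
  have hθle : ∀ {i j : ℕ}, j ≤ i → θ ^ i ≤ θ ^ j := fun h => pow_le_pow_of_le_one hθ.le hθ1 h
  have hp0 : 0 ≤ p := by rw [hp]; exact mul_nonneg ha (hθk _)
  have hrem : expRem p ≤ p ^ 2 := expRem_le_sq hp0 hp1
  have hexp : Real.exp p - 1 ≤ 2 * p := by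
    have hp2 : p ^ 2 ≤ p := by nlinarith
    have h := hrem
    unfold expRem at h
    linarith
  have e42 : θ ^ (18 * k) * θ ^ (24 * k) = θ ^ (42 * k) := by rw [← pow_add]; congr 1; ring
  have e48 : θ ^ (24 * k) * θ ^ (24 * k) = θ ^ (48 * k) := by rw [← pow_add]; congr 1; ring
  have h42 : θ ^ (42 * k) ≤ θ ^ (38 * k) := hθle (by omega)
  have h48 : θ ^ (48 * k) ≤ θ ^ (38 * k) := hθle (by omega)
  refine ⟨?_, ?_⟩
  · calc D ≤ Real.exp p - 1 := hD
      _ ≤ 2 * p := hexp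
      _ = 2 * a * θ ^ (24 * k) := by rw [hp]; ring
  have t1 : σ₁ * θ ^ (18 * k) * (Real.exp p - 1) ≤ 2 * a * σ₁ * θ ^ (38 * k) := by
    calc σ₁ * θ ^ (18 * k) * (Real.exp p - 1) ≤ σ₁ * θ ^ (18 * k) * (2 * p) :=
          mul_le_mul_of_nonneg_left hexp (mul_nonneg hσ₁ (hθk _))
      _ = 2 * a * σ₁ * (θ ^ (18 * k) * θ ^ (24 * k)) := by rw [hp]; ring
      _ ≤ 2 * a * σ₁ * θ ^ (38 * k) := by
          rw [e42]; exact mul_le_mul_of_nonneg_left h42 (by positivity)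
  have t2 : 2 * expRem p ≤ 2 * a ^ 2 * θ ^ (38 * k) := by
    calc 2 * expRem p ≤ 2 * p ^ 2 := by linarith
      _ = 2 * a ^ 2 * (θ ^ (24 * k) * θ ^ (24 * k)) := by rw [hp]; ring
      _ ≤ 2 * a ^ 2 * θ ^ (38 * k) := by
          rw [e48]; exact mul_le_mul_of_nonneg_left h48 (by positivity)
  have t4 : 2 * (σ₀ * θ ^ (18 * k)) * p ≤ 2 * a * σ₀ * θ ^ (38 * k) := by
    calc 2 * (σ₀ * θ ^ (18 * k)) * p = 2 * a * σ₀ * (θ ^ (18 * k) * θ ^ (24 * k)) := by rw [hp]; ring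
      _ ≤ 2 * a * σ₀ * θ ^ (38 * k) := by
          rw [e42]; exact mul_le_mul_of_nonneg_left h42 (by positivity)
  calc G ≤ σ₁ * θ ^ (18 * k) * (Real.exp p - 1) + 2 * expRem p + q + 2 * (σ₀ * θ ^ (18 * k)) * p := hG
    _ ≤ 2 * a * σ₁ * θ ^ (38 * k) + 2 * a ^ 2 * θ ^ (38 * k) + c * θ ^ (38 * k) + 2 * a * σ₀ * θ ^ (38 * k) := by
          rw [hq] at *; linarith
    _ = (c + 2 * a * (σ₀ + σ₁) + 2 * a ^ 2) * θ ^ (38 * k) := by ring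

/-- **THE (1.13) FIELD-UNIT READING IS GEOMETRIC** at base `θ^{18} = L⁻¹`: `D ≤ A·θ^{24k}` read in potential units `ξ = θ^{18k}` and
`G ≤ C_G·θ^{38k}` read in gradient units `ξ² = θ^{36k}` are both `≤ (A + C_G)·θ^k`. [folklore] -/
theorem plain_reading_le_H {θ A C_G D G : ℝ} {k : ℕ} (hθ : 0 < θ) (hθ1 : θ ≤ 1) (hA : 0 ≤ A) (hCG : 0 ≤ C_G)
    (hD : D ≤ A * θ ^ (24 * k)) (hGr : G ≤ C_G * θ ^ (38 * k)) :
    max (D / θ ^ (18 * k)) (G / θ ^ (36 * k)) ≤ (A + C_G) * θ ^ k := by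
  have hθ18 : 0 < θ ^ (18 * k) := pow_pos hθ _
  have hθ36 : 0 < θ ^ (36 * k) := pow_pos hθ _
  have hθle : ∀ {i j : ℕ}, j ≤ i → θ ^ i ≤ θ ^ j := fun h => pow_le_pow_of_le_one hθ.le hθ1 h
  have e24 : θ ^ (24 * k) = θ ^ (6 * k) * θ ^ (18 * k) := by rw [← pow_add]; congr 1; ring
  have e38 : θ ^ (38 * k) = θ ^ (2 * k) * θ ^ (36 * k) := by rw [← pow_add]; congr 1; ring
  have h6k : θ ^ (6 * k) ≤ θ ^ k := hθle (by omega)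
  have h2k : θ ^ (2 * k) ≤ θ ^ k := hθle (by omega)
  refine max_le ?_ ?_
  · rw [div_le_iff₀ hθ18]
    calc D ≤ A * θ ^ (24 * k) := hD
      _ = A * θ ^ (6 * k) * θ ^ (18 * k) := by rw [e24]; ring
      _ ≤ A * θ ^ k * θ ^ (18 * k) := mul_le_mul_of_nonneg_right (mul_le_mul_of_nonneg_left h6k hA) hθ18.le
      _ ≤ (A + C_G) * θ ^ k * θ ^ (18 * k) := by gcongr; linarith
  · rw [div_le_iff₀ hθ36]
    calc G ≤ C_G * θ ^ (38 * k) := hGr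
      _ = C_G * θ ^ (2 * k) * θ ^ (36 * k) := by rw [e38]; ring
      _ ≤ C_G * θ ^ k * θ ^ (36 * k) := mul_le_mul_of_nonneg_right (mul_le_mul_of_nonneg_left h2k hCG) hθ36.le
      _ ≤ (A + C_G) * θ ^ k * θ ^ (36 * k) := by gcongr; linarith

/-! ## §2 The plain quantities at the amended rates -/

/-- **THE PLAIN QUANTITIES AT RATE** (`d = 4`, base `θ^{18} = L⁻¹`): `W` unitary with smooth-gauge letters `‖W_b − 1‖ ≤ σ₀θ^{18k}`,
`‖∇W‖ ≤ σ₁θ^{18k}`; (P) `‖Z‖ ≤ a·θ^{24k}` with `a ≥ 0`, `aθ^{24k} ≤ 1`; (Gᶜ) `≤ c·θ^{38k}` ⟹ (i) `‖(W e^Z)(b) − W(b)‖ ≤ 2a·θ^{24k}`; (ii) the plain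
gradient of `W e^Z − W` is `≤ (c + 2a(σ₀ + σ₁) + 2a²)·θ^{38k}`. [folklore] -/
theorem plain_letters_of_rates_H [Nonempty n] {W : Site 4 → Fin 4 → (Matrix n n ℂ)ˣ} (hW : IsUnitaryCfg W)
    {Z : Site 4 → Fin 4 → Matrix n n ℂ} {θ a c σ₀ σ₁ : ℝ} {k : ℕ} (hθ : 0 < θ) (hθ1 : θ ≤ 1) (ha : 0 ≤ a)
    (hσ₀ : 0 ≤ σ₀) (hσ₁ : 0 ≤ σ₁) (hp1 : a * θ ^ (24 * k) ≤ 1)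
    (hP : ∀ (x : Site 4) (κ : Fin 4), ‖Z x κ‖ ≤ a * θ ^ (24 * k))
    (hG : ∀ (x : Site 4) (μ κ : Fin 4), ‖Ad (W (x + e κ) μ) (Z (x + e μ) κ) - Z x κ‖ ≤ c * θ ^ (38 * k))
    (hs₀ : ∀ x κ, ‖((W x κ : (Matrix n n ℂ)ˣ) : Matrix n n ℂ) - 1‖ ≤ σ₀ * θ ^ (18 * k))
    (hs₁ : ∀ x μ κ, ‖((W (x + e μ) κ : (Matrix n n ℂ)ˣ) : Matrix n n ℂ) - ((W x κ : (Matrix n n ℂ)ˣ) : Matrix n n ℂ)‖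
      ≤ σ₁ * θ ^ (18 * k)) :
    (∀ (x : Site 4) (κ : Fin 4),
        ‖((vary W Z 1 x κ : (Matrix n n ℂ)ˣ) : Matrix n n ℂ) - ((W x κ : (Matrix n n ℂ)ˣ) : Matrix n n ℂ)‖ ≤ 2 * a * θ ^ (24 * k)) ∧
    (∀ (x : Site 4) (μ κ : Fin 4),
        ‖(((vary W Z 1 (x + e μ) κ : (Matrix n n ℂ)ˣ) : Matrix n n ℂ) - ((W (x + e μ) κ : (Matrix n n ℂ)ˣ) : Matrix n n ℂ))
            - (((vary W Z 1 x κ : (Matrix n n ℂ)ˣ) : Matrix n n ℂ) - ((W x κ : (Matrix n n ℂ)ˣ) : Matrix n n ℂ))‖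
          ≤ (c + 2 * a * (σ₀ + σ₁) + 2 * a ^ 2) * θ ^ (38 * k)) := by
  have hp0 : 0 ≤ a * θ ^ (24 * k) := mul_nonneg ha (pow_nonneg hθ.le _)
  have hx1 : 0 ≤ Real.exp (a * θ ^ (24 * k)) - 1 := by linarith [Real.add_one_le_exp (a * θ ^ (24 * k))]
  refine ⟨fun x κ => ?_, fun x μ κ => ?_⟩
  · have h := (letters_at_rates_H (G := 0) (c := c) (σ₀ := σ₀) (σ₁ := σ₁) hθ hθ1 ha hσ₀ hσ₁ rfl hp1 rfl (norm_plainSup_le hW hP x κ) ?_).1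
    · exact h
    · have hq0 : 0 ≤ c * θ ^ (38 * k) := by
        have := norm_nonneg (Ad (W (x + e κ) κ) (Z (x + e κ) κ) - Z x κ)
        linarith [hG x κ κ]
      have := expRem_nonneg (a * θ ^ (24 * k))
      have hθ18 : 0 ≤ θ ^ (18 * k) := pow_nonneg hθ.le _
      positivity
  · exact (letters_at_rates_H (D := 0) (c := c) hθ hθ1 ha hσ₀ hσ₁ rfl hp1 rfl hx1
      (norm_plainGrad_le hW hP (fun κ' x' μ' => hG x' μ' κ') hs₀ hs₁ x μ κ)).2

/-! ## §3 The plain reading from the amended socket `h′` and ONE smooth-gauge letter on `U_B` -/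

/-- **THE BACKGROUND COORDINATE IN THE PLAIN READING FROM `h′` + ONE SMOOTH-GAUGE LETTER ON `U_B`** (`d = 4`, base `θ^{18} = L⁻¹`): hypotheses of
`NE7EtaClosenessHolder.closeness_of_covRootH` verbatim, plus `θ ≤ 1`, `8l₁²γθ^{24k} ≤ 1`, and: the given run-B minimiser is bondwise `exp A_B` with
`sup‖A_B‖ ≤ σ_B·θ^{18(k+1)}` (`σ_B ≥ 0`) with `10L·σ_Bθ^{18(k+1)} ≤ 1∕64`.  THEN `∃ u Z` with the representation and (i) bond distance `≤ 16l₁²γ·θ^{24k}`,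
(ii) plain gradient `≤ ((16l₁²γ + √2Λ_H) + 16l₁²γ(60σ_B) + 128l₁⁴γ²)·θ^{38k}`. [folklore] -/
theorem plain_closeness_of_covRootH_oneLetter [Nonempty n] {𝒞 : ℕ → Set (Site 4 → Fin 4 → (Matrix n n ℂ)ˣ)} {L N : ℕ}
    (hL : 2 ≤ L) (hN : 1 ≤ N) {θ : ℝ} (hθ : 0 < θ) (hθ1 : θ ≤ 1) (hθ18 : θ ^ 18 = ((L : ℝ))⁻¹) {b g C Λ₁ ΛH : ℝ}
    (hb : 0 ≤ b) (hbs : 512 * (4 + 1) * (4 + 4) * (L : ℝ) ^ 2 * b ≤ 1) (hg : 0 ≤ g) (hC : 0 ≤ C) (hΛH : 0 ≤ ΛH)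
    {dom : Set (Site 4 → Fin 4 → (Matrix n n ℂ)ˣ)}
    (h : ∀ k : ℕ, 1 ≤ k → ∀ V ∈ dom, ∀ UA UB : Site 4 → Fin 4 → (Matrix n n ℂ)ˣ,
      IsMinimiser 4 𝒞 L N k V UA → IsMinimiser 4 𝒞 L N (k + 1) V UB → Regular 4 L N b g (k + 1) UB →
        ∃ (u : Site 4 → (Matrix n n ℂ)ˣ) (Z : Site 4 → Fin 4 → Matrix n n ℂ),
          IsUnitarySite u ∧ IsPeriodicSite u ((N * L ^ k : ℕ) : ℤ) ∧
          IsSkewDir Z ∧ IsPeriodicDir Z ((N * L ^ k : ℕ) : ℤ) ∧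
          gaugeAct u UA = vary (rescale L (bavg L UB)) Z 1 ∧
          energyNormW L k (rescale L (bavg L UB)) Z (periodBox (N * L ^ k)) ≤ C * residualScale 4 L N b g k ∧
          (∀ (κ : Fin 4) (x : Site 4) (μ : Fin 4),
            ‖Ad (rescale L (bavg L UB) (x + e κ) μ) (Z (x + e μ) κ) - Z x κ‖ ≤ Λ₁ * (((L : ℝ)⁻¹) ^ k) ^ 2) ∧
          (∀ (κ μ : Fin 4) (y : Site 4) (j : ℕ),
            ‖Ad (((List.range j).map fun i : ℕ => rescale L (bavg L UB) (y + e κ + i • e μ) μ).prod)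
                  (Ad (rescale L (bavg L UB) (y + j • e μ + e κ) μ) (Z (y + j • e μ + e μ) κ) - Z (y + j • e μ) κ)
                - (Ad (rescale L (bavg L UB) (y + e κ) μ) (Z (y + e μ) κ) - Z y κ)‖
              ≤ ΛH * Real.sqrt (j : ℝ) * (((L : ℝ)⁻¹) ^ k) ^ 2 * Real.sqrt (((L : ℝ)⁻¹) ^ k)))
    {γ l₁ : ℝ} (hγ : 0 < γ)
    (hγ3 : C * (wallConst 4 L * (N : ℝ) ^ 2 * (Real.sqrt g * dualC2 4 L + 2 * b ^ 2 * dualC1 4 L)) ≤ γ ^ 3)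
    (hl₁ : 0 < l₁) (hΛl₁ : Λ₁ ≤ l₁ ^ 3)
    {k : ℕ} (hk : 1 ≤ k) (hfit : γ * ((θ ^ 3) ^ k) ^ 2 ≤ l₁ * N) (hp1 : 8 * l₁ ^ 2 * γ * θ ^ (24 * k) ≤ 1)
    {V : Site 4 → Fin 4 → (Matrix n n ℂ)ˣ} (hV : V ∈ dom) {UA UB : Site 4 → Fin 4 → (Matrix n n ℂ)ˣ}
    (hA : IsMinimiser 4 𝒞 L N k V UA) (hB : IsMinimiser 4 𝒞 L N (k + 1) V UB) (hreg : Regular 4 L N b g (k + 1) UB)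
    {σB : ℝ} (hσB : 0 ≤ σB) {AB : Site 4 → Fin 4 → Matrix n n ℂ}
    (hUB : ∀ x κ, ((UB x κ : (Matrix n n ℂ)ˣ) : Matrix n n ℂ) = exp (AB x κ) ∧ ‖AB x κ‖ ≤ σB * θ ^ (18 * (k + 1)))
    (hsmooth : 10 * (L : ℝ) * (σB * θ ^ (18 * (k + 1))) ≤ 1 / 64) :
    ∃ (u : Site 4 → (Matrix n n ℂ)ˣ) (Z : Site 4 → Fin 4 → Matrix n n ℂ),
      IsUnitarySite u ∧ IsPeriodicSite u ((N * L ^ k : ℕ) : ℤ) ∧ IsSkewDir Z ∧ IsPeriodicDir Z ((N * L ^ k : ℕ) : ℤ) ∧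
      gaugeAct u UA = vary (rescale L (bavg L UB)) Z 1 ∧
      (∀ (x : Site 4) (κ : Fin 4),
        ‖((gaugeAct u UA x κ : (Matrix n n ℂ)ˣ) : Matrix n n ℂ) - ((rescale L (bavg L UB) x κ : (Matrix n n ℂ)ˣ) : Matrix n n ℂ)‖
          ≤ 16 * l₁ ^ 2 * γ * θ ^ (24 * k)) ∧
      (∀ (x : Site 4) (μ κ : Fin 4),
        ‖(((gaugeAct u UA (x + e μ) κ : (Matrix n n ℂ)ˣ) : Matrix n n ℂ)
              - ((rescale L (bavg L UB) (x + e μ) κ : (Matrix n n ℂ)ˣ) : Matrix n n ℂ))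
            - (((gaugeAct u UA x κ : (Matrix n n ℂ)ˣ) : Matrix n n ℂ)
              - ((rescale L (bavg L UB) x κ : (Matrix n n ℂ)ˣ) : Matrix n n ℂ))‖
          ≤ ((16 * l₁ ^ 2 * γ + Real.sqrt 2 * ΛH) + 16 * l₁ ^ 2 * γ * (60 * σB) + 128 * l₁ ^ 4 * γ ^ 2) * θ ^ (38 * k)) := by
  have hL1 : 1 ≤ L := by omega
  have hL0 : (0 : ℝ) < L := by exact_mod_cast (by omega : 0 < L)
  -- the rates from `h′`
  obtain ⟨u, Z, hu, huP, hZ, hZP, hrep, hPr, hGr, -⟩ :=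
    closeness_of_covRootH hL hN hθ hθ18 hb hbs hg hC hΛH h hγ hγ3 hl₁ hΛl₁ hk hfit hV hA hB hreg
  obtain ⟨hWu, -⟩ := unitary_periodic_rescale_bavg_of_regular hL1 hb hbs hreg
  -- the averaged letter: `‖W_b − 1‖ ≤ 2·(10L)·σ_B θ^{18(k+1)} = 20σ_B·(L θ^{18(k+1)}) = 20σ_B·θ^{18k}`
  have hlen : ((2 * (4 * L) + L + L : ℕ) : ℝ) = 10 * (L : ℝ) := by push_cast; ring
  have ha0 : 0 ≤ σB * θ ^ (18 * (k + 1)) := mul_nonneg hσB (pow_nonneg hθ.le _)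
  have hsmall' : ((2 * (4 * L) + L + L : ℕ) : ℝ) * (σB * θ ^ (18 * (k + 1))) ≤ 1 / 64 := by rw [hlen]; exact hsmooth
  have hW0 : ∀ x κ, ‖((rescale L (bavg L UB) x κ : (Matrix n n ℂ)ˣ) : Matrix n n ℂ) - 1‖ ≤ (20 * σB) * θ ^ (18 * k) := by
    intro x κ
    have h1 := norm_rescale_bavg_sub_one_le (d := 4) hL1 ha0 hUB hsmall' x κ
    rw [hlen] at h1
    have e18 : (L : ℝ) * θ ^ (18 * (k + 1)) = θ ^ (18 * k) := by
      have : θ ^ (18 * (k + 1)) = θ ^ (18 * k) * θ ^ 18 := by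
        rw [show 18 * (k + 1) = 18 * k + 18 by ring, pow_add]
      rw [this, hθ18]
      field_simp
    calc _ ≤ 2 * (10 * (L : ℝ) * (σB * θ ^ (18 * (k + 1)))) := h1
      _ = 20 * σB * ((L : ℝ) * θ ^ (18 * (k + 1))) := by ring
      _ = 20 * σB * θ ^ (18 * k) := by rw [e18]
  have hW1 : ∀ x μ κ, ‖((rescale L (bavg L UB) (x + e μ) κ : (Matrix n n ℂ)ˣ) : Matrix n n ℂ)
      - ((rescale L (bavg L UB) x κ : (Matrix n n ℂ)ˣ) : Matrix n n ℂ)‖ ≤ (40 * σB) * θ ^ (18 * k) := by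
    intro x μ κ
    have h2 := letter_grad_of_sup hW0 x μ κ
    linarith
  have h20 : 0 ≤ 20 * σB := by positivity
  have h40 : 0 ≤ 40 * σB := by positivity
  have ha : 0 ≤ 8 * l₁ ^ 2 * γ := by positivity
  obtain ⟨hsup, hgrad⟩ := plain_letters_of_rates_H (c := 16 * l₁ ^ 2 * γ + Real.sqrt 2 * ΛH) hWu hθ hθ1 ha h20 h40 hp1 hPr hGr hW0 hW1
  have e1 : 2 * (8 * l₁ ^ 2 * γ) = 16 * l₁ ^ 2 * γ := by ring
  have e2 : (16 * l₁ ^ 2 * γ + Real.sqrt 2 * ΛH) + 2 * (8 * l₁ ^ 2 * γ) * (20 * σB + 40 * σB) + 2 * (8 * l₁ ^ 2 * γ) ^ 2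
      = (16 * l₁ ^ 2 * γ + Real.sqrt 2 * ΛH) + 16 * l₁ ^ 2 * γ * (60 * σB) + 128 * l₁ ^ 4 * γ ^ 2 := by ring
  refine ⟨u, Z, hu, huP, hZ, hZP, hrep, ?_, ?_⟩
  · intro x κ
    rw [hrep, ← e1]
    exact hsup x κ
  · intro x μ κ
    rw [hrep, ← e2]
    exact hgrad x μ κ

end

/-! ## §4 The plain reading at the amended rates -/

section Reading

variable {n : Type} [Fintype n] [DecidableEq n]

/-- `θ^{18} = L⁻¹` ⟹ `L^k = (θ^{18k})⁻¹`. [folklore] -/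
theorem pow_level_eq18 {L : ℕ} {θ : ℝ} (hθ18 : θ ^ 18 = ((L : ℝ))⁻¹) (k : ℕ) : (L : ℝ) ^ k = (θ ^ (18 * k))⁻¹ := by
  rw [pow_mul, hθ18, inv_pow, inv_inv]

/-- **THE PLAIN READING AT RATE** (`d = 4`, base `θ^{18} = L⁻¹`): pointwise bond distance `≤ A·θ^{24k}` and pointwise plain gradient `≤ C_G·θ^{38k}`
everywhere give `plainReading L N k U U′ ≤ (A + C_G)·θ^k`. [folklore] -/
theorem plainReading_le_rate_H {L N k : ℕ} {θ A C_G : ℝ} (hθ : 0 < θ) (hθ1 : θ ≤ 1) (hθ18 : θ ^ 18 = ((L : ℝ))⁻¹)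
    (hA : 0 ≤ A) (hCG : 0 ≤ C_G) {U U' : Site 4 → Fin 4 → (Matrix n n ℂ)ˣ}
    (hv : ∀ (x : Site 4) (κ : Fin 4),
      ‖((U x κ : (Matrix n n ℂ)ˣ) : Matrix n n ℂ) - ((U' x κ : (Matrix n n ℂ)ˣ) : Matrix n n ℂ)‖ ≤ A * θ ^ (24 * k))
    (hgr : ∀ (x : Site 4) (μ κ : Fin 4),
      ‖(((U (x + e μ) κ : (Matrix n n ℂ)ˣ) : Matrix n n ℂ) - ((U' (x + e μ) κ : (Matrix n n ℂ)ˣ) : Matrix n n ℂ))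
          - (((U x κ : (Matrix n n ℂ)ˣ) : Matrix n n ℂ) - ((U' x κ : (Matrix n n ℂ)ˣ) : Matrix n n ℂ))‖ ≤ C_G * θ ^ (38 * k)) :
    plainReading L N k U U' ≤ (A + C_G) * θ ^ k := by
  have hD0 : 0 ≤ A * θ ^ (24 * k) := by positivity
  have hG0 : 0 ≤ C_G * θ ^ (38 * k) := by positivity
  have h1 := reading_le (L := L) (N := N) (k := k) (F := diffCfg U U') hD0 hG0 (fun x _ κ => hv x κ)
    (fun x _ μ κ => hgr x μ κ)
  have h2 := plain_reading_le_H (D := A * θ ^ (24 * k)) (G := C_G * θ ^ (38 * k)) (k := k) hθ hθ1 hA hCG le_rfl le_rfl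
  have e1 : (L : ℝ) ^ k * (A * θ ^ (24 * k)) = A * θ ^ (24 * k) / θ ^ (18 * k) := by
    rw [pow_level_eq18 hθ18, div_eq_mul_inv, mul_comm]
  have e2 : ((L : ℝ) ^ k) ^ 2 * (C_G * θ ^ (38 * k)) = C_G * θ ^ (38 * k) / θ ^ (36 * k) := by
    rw [pow_level_eq18 hθ18, inv_pow, ← pow_mul, show 18 * k * 2 = 36 * k by ring, div_eq_mul_inv, mul_comm]
  unfold plainReading
  rw [e1, e2] at h1
  exact h1.trans h2

end Reading

end Summit.QuantumFields.BalabanUV.T4Continuum.NE7EtaPlainGradientHolder
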